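import Literature.Analysis.FunctionSpaces.TorusClassicalNSLinearisation
import Literature.Analysis.FunctionSpaces.TorusLinearisedNSForcedH1Balance
import Literature.Analysis.FunctionSpaces.TorusConvectionSelfL2
import HarnessLib

/-!
# The linearisation remainder of classical Navier–Stokes solutions on `T³`, II: the `H¹`
# estimate (Fréchet differentiability of the solution map in `V = H¹`)

Function-space support file (all results proved; no definitions, no named facts), sequel of
`TorusClassicalNSLinearisation` (the `L²` remainder estimate
`∫ ‖(u₂ − u₁ − w)(t)‖² ≤ K ‖(u₂ − u₁)(a)‖⁴_{H¹}`) and `TorusLinearisedNSForcedH1Balance` (the `H¹`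
balance of the inhomogeneous linearised equation). Setting: two classical solutions `(u₁, p₁)`,
`(u₂, p₂)` on `[a, a + τ] × T^d`, `card d = 3`, same viscosity `ν > 0` and force, zero-mean slices,
`‖u₁‖, ‖u₂‖ ≤ M`, `‖∂ᵢu₁‖ ≤ Cᵢ`, `∑ᵢCᵢ ≤ Λ`; a smooth solution `(w, q)` of the linearised equation
along `u₁` with `w(a) = (u₂ − u₁)(a)`; `δ = u₂ − u₁`, `r = δ − w`, `H₀ = ∫‖δ(a)‖² + ‖∇δ(a)‖₂²`.

* `Torus.IsClassicalNSSolutionOn.exists_gradNormSq_sub_sub_le` — the `H¹` REMAINDER ESTIMATE: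
  `‖∇r(t)‖₂² ≤ K H₀²` on `[a, a + τ]`, `K = K(ν, M, Λ, τ)`;
* `Torus.IsClassicalNSSolutionOn.exists_h1_sub_sub_le` — with part I:
  `∫‖r(t)‖² + ‖∇r(t)‖₂² ≤ K H₀²`, i.e.
  `‖S(t)u₂(a) − S(t)u₁(a) − S'(t,u₁)(u₂ − u₁)(a)‖_{H¹} ≤ √K ‖(u₂ − u₁)(a)‖²_{H¹}` uniformly over
  pairs obeying the coefficient bounds: the linearised flow is the Fréchet derivative of the
  solution map of `V` INTO `V` (Constantin–Foias 1988, Lemma 14.3, in `H` for `n = 2`; Temam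
  1997, Ch. VI (3.12) and §8, the differentiability of the semigroup).

Proof of the `H¹` estimate (pointwise in time, no time integrals): `r` solves the linearised
equation along `u₁` with source `g = −(δ·∇)δ`, so (`Torus.linearisedNSForced_gradNormSq_flux_le`)
`V_r' ≤ (4·3M²/ν)V_r + (4Λ²/ν)E_r + (2/ν)∫‖g‖²`, where `E_r ≤ K_B H₀²` by part I and
`∫‖g‖² ≤ c₁ H₀ ‖Δδ‖₂²` by `Torus.integral_norm_sq_convect_self_le`,
`Torus.exists_integral_sum_norm_partialDeriv_sq_sq_le` (`TorusConvectionSelfL2`) and `∫‖δ‖⁴ ≤ K₄H₀²`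
(`….exists_integral_norm_sub_pow_four_le`). The dangerous factor `‖Δδ(s)‖₂²` is cancelled by the
dissipation of the perturbation itself: `V_δ' ≤ −ν‖Δδ‖₂² + (2/ν)(3M²V_δ + Λ²E_δ)` (the difference
enstrophy balance with half the dissipation kept), so the Lyapunov combination
`Φ = V_r + λH₀V_δ`, `λ = 2c₁/ν²`, obeys `Φ' ≤ K₁Φ + c₂H₀²` (`E_δ + V_δ ≤ H₀e^{K'τ}` by
`….h1_sub_le_mul_exp`), and Grönwall gives `V_r(t) ≤ Φ(t) ≤ (λ + c₂τ)e^{K₁τ} H₀²`.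

## Mathlib / tree search

Tree (`lean search 'sub_sub.*gradNormSq|h1_sub_sub'`): none; reused: part I,
`TorusLinearisedNSForcedH1Balance`, `TorusConvectionSelfL2`, `….hasDerivWithinAt_gradNormSq_sub` and
`Torus.integral_norm_sq_convect_add_convect_le` (`TorusClassicalNSDifferenceBalances`), the Young
lemma `Literature.Analysis.FluidPDE.Torus.neg_mul_integral_norm_sq_add_integral_inner_le`,
`Literature.Analysis.ODE.gronwallBound_le_mul_exp`; Mathlib `le_gronwallBound_of_liminf_deriv_right_le`.

## References

* P. Constantin, C. Foias, *Navier–Stokes Equations*, Univ. Chicago Press 1988, Ch. 14,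
  Lemma 14.3 (14.10), Prop. 13.2. [`ConstantinFoiasNSE1988`]
* R. Temam, *Infinite-Dimensional Dynamical Systems in Mechanics and Physics*, 2nd ed., Springer
  1997, Ch. III §6.1–6.2, Ch. VI §3.1 (3.12) and §8 (differentiability of the semigroup). [`Temam1997`]
-/

open MeasureTheory Set Filter
open scoped InnerProductSpace ContDiff Topology

noncomputable section

namespace Literature.Analysis.FunctionSpaces

namespace Torus

variable {d : Type*} [Fintype d] [DecidableEq d]

/-- `‖∇0‖₂² = 0` (the line derivatives of a constant vanish). [folklore] -/
private theorem gradNormSq_fun_zero :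
    gradNormSq (fun _ : UnitAddTorus d => (0 : EuclideanSpace ℝ d)) = 0 := by
  simp [gradNormSq, partialDeriv, lineDeriv]

section Three

variable {ν M Λ τ : ℝ}

/-- **The `H¹` linearisation remainder estimate on `T³`.** On `T^d` with `card d = 3`, for
`ν > 0`, `Λ ≥ 0`, `τ > 0` and `M` there is `K ≥ 0` (depending only on these) such that: for two
classical solutions `(u₁, p₁)`, `(u₂, p₂)` on `[a, a + τ] × T^d` (same viscosity `ν` and force)
with zero-mean slices, `‖u₁‖ ≤ M`, `‖u₂‖ ≤ M`, `‖∂ᵢu₁‖ ≤ Cᵢ`, `∑ᵢCᵢ ≤ Λ`, and every smooth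
solution `(w, q)` of the linearised equation along `u₁` on `[a, a + τ]` with
`w(a) = u₂(a) − u₁(a)`, the remainder `r = u₂ − u₁ − w` satisfies
`‖∇r(t)‖₂² ≤ K (∫‖(u₂ − u₁)(a)‖² + ‖∇(u₂ − u₁)(a)‖₂²)²` for all `t ∈ [a, a + τ]` (the Lyapunov
combination `‖∇r‖₂² + λH₀‖∇(u₂ − u₁)‖₂²` described in the module docstring; the `V`-level
remainder estimate behind the Fréchet differentiability of `S(t) : V → V`, Constantin–Foias 1988,
Lemma 14.3 with Prop. 13.2). [cite: ConstantinFoiasNSE1988, Ch. 14 Lemma 14.3 (14.10)] -/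
theorem IsClassicalNSSolutionOn.exists_gradNormSq_sub_sub_le (hd : Fintype.card d = 3)
    (hν : 0 < ν) (hΛ : 0 ≤ Λ) (hτ : 0 < τ) (M : ℝ) :
    ∃ K : ℝ, 0 ≤ K ∧ ∀ {a : ℝ} {f u₁ u₂ w : ℝ → UnitAddTorus d → EuclideanSpace ℝ d}
      {p₁ p₂ q : ℝ → UnitAddTorus d → ℝ} {C : d → ℝ},
      IsClassicalNSSolutionOn (Icc a (a + τ)) ν f u₁ p₁ →
      IsClassicalNSSolutionOn (Icc a (a + τ)) ν f u₂ p₂ →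
      (∀ t ∈ Icc a (a + τ), HasZeroMean (u₁ t)) → (∀ t ∈ Icc a (a + τ), HasZeroMean (u₂ t)) →
      (∀ t ∈ Icc a (a + τ), ∀ x, ‖u₁ t x‖ ≤ M) → (∀ t ∈ Icc a (a + τ), ∀ x, ‖u₂ t x‖ ≤ M) →
      (∀ i, ∀ t ∈ Icc a (a + τ), ∀ x, ‖partialDeriv i (u₁ t) x‖ ≤ C i) → ∑ i, C i ≤ Λ →
      IsSmoothSpaceTimeOn (Icc a (a + τ)) w → IsSmoothSpaceTimeOn (Icc a (a + τ)) q →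
      (∀ t ∈ Icc a (a + τ), IsDivFree (w t)) →
      (∀ t ∈ Icc a (a + τ), ∀ x, timeDerivWithin (Icc a (a + τ)) w t x + convect (u₁ t) (w t) x +
        convect (w t) (u₁ t) x = ν • laplacian (w t) x - gradient (q t) x) →
      (∀ y, w a y = u₂ a y - u₁ a y) →
      ∀ t ∈ Icc a (a + τ), gradNormSq (fun y => u₂ t y - u₁ t y - w t y) ≤
        K * ((∫ x, ‖u₂ a x - u₁ a x‖ ^ 2) + gradNormSq (fun y => u₂ a y - u₁ a y)) ^ 2 := by
  obtain ⟨KB, hKB0, hKB⟩ :=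
    IsClassicalNSSolutionOn.exists_integral_norm_sub_sub_sq_le (d := d) hd hν hΛ hτ M
  obtain ⟨K₄, hK₄0, hK₄⟩ :=
    IsClassicalNSSolutionOn.exists_integral_norm_sub_pow_four_le (d := d) hd hν hΛ hτ M
  obtain ⟨KG, hKG0, hKG⟩ := exists_integral_sum_norm_partialDeriv_sq_sq_le (d := d) hd
  -- the constants
  set Dd : ℝ := Fintype.card d * M ^ 2 with hDd
  have hDd0 : 0 ≤ Dd := by positivity
  set K' : ℝ := 2 * Λ + (Λ ^ 2 + Fintype.card d * M ^ 2) / ν with hK'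
  have hK'0 : 0 ≤ K' := by positivity
  set c₁ : ℝ := Real.sqrt K₄ * Real.sqrt KG with hc₁
  have hc₁0 : 0 ≤ c₁ := by positivity
  set lam : ℝ := 2 * c₁ / ν ^ 2 with hlam
  have hlam0 : 0 ≤ lam := by positivity
  set K₁ : ℝ := 4 * Dd / ν with hK₁
  have hK₁0 : 0 ≤ K₁ := by positivity
  set c₂ : ℝ := 4 * Λ ^ 2 / ν * KB + lam * (2 / ν) * (Dd + Λ ^ 2) * Real.exp (K' * τ) with hc₂
  have hc₂0 : 0 ≤ c₂ := by positivity
  refine ⟨(lam + c₂ * τ) * Real.exp (K₁ * τ), by positivity, ?_⟩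
  intro a f u₁ u₂ w p₁ p₂ q C h₁ h₂ hz₁ hz₂ hM₁ hM₂ hC hCΛ hw hq hwdiv hlin h0 t ht
  set b : ℝ := a + τ with hb
  have hab : a < b := by rw [hb]; linarith
  have ha : a ∈ Icc a b := left_mem_Icc.2 hab.le
  set H₀ : ℝ := (∫ x, ‖u₂ a x - u₁ a x‖ ^ 2) + gradNormSq (fun y => u₂ a y - u₁ a y) with hH₀
  have hH₀0 : 0 ≤ H₀ := add_nonneg (integral_nonneg fun x => sq_nonneg _) (gradNormSq_nonneg _)
  have hL0 : 0 ≤ ∑ i, C i := Finset.sum_nonneg fun i _ => (norm_nonneg _).trans (hC i a ha 0)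
  -- the perturbation, the remainder, its pressure and its source
  set δ : ℝ → UnitAddTorus d → EuclideanSpace ℝ d := fun s y => u₂ s y - u₁ s y with hδ_def
  set r : ℝ → UnitAddTorus d → EuclideanSpace ℝ d := fun s y => δ s y - w s y with hr_def
  set π : ℝ → UnitAddTorus d → ℝ := fun s y => (p₂ s y - p₁ s y) - q s y with hπ_def
  set G : ℝ → UnitAddTorus d → EuclideanSpace ℝ d := fun s y => -convect (δ s) (δ s) y with hG_def
  set Z : ℝ → UnitAddTorus d → EuclideanSpace ℝ d := fun _ _ => 0 with hZ_def
  set GZ : ℝ → UnitAddTorus d → EuclideanSpace ℝ d := fun s y => G s y - Z s y with hGZ_def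
  have hδ : IsSmoothSpaceTimeOn (Icc a b) δ := h₂.smooth_velocity.sub h₁.smooth_velocity
  have hr : IsSmoothSpaceTimeOn (Icc a b) r := hδ.sub hw
  have hp21 : IsSmoothSpaceTimeOn (Icc a b) (fun s y => p₂ s y - p₁ s y) :=
    h₂.smooth_pressure.sub h₁.smooth_pressure
  have hπ : IsSmoothSpaceTimeOn (Icc a b) π := hp21.sub hq
  have hδdiv : ∀ s ∈ Icc a b, IsDivFree (δ s) := by
    intro s hs x
    have hu₁ : IsSmooth (u₁ s) := h₁.smooth_velocity.isSmooth_slice hs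
    have hu₂ : IsSmooth (u₂ s) := h₂.smooth_velocity.isSmooth_slice hs
    have hδ' : δ s = u₂ s - u₁ s := rfl
    rw [hδ', divergence_sub (hu₂.isContDiff (by simp)) (hu₁.isContDiff (by simp)),
      h₂.divFree s hs x, h₁.divFree s hs x, sub_zero]
  have hrdiv : ∀ s ∈ Icc a b, IsDivFree (r s) := by
    intro s hs x
    have hδs : IsSmooth (δ s) := hδ.isSmooth_slice hs
    have hws : IsSmooth (w s) := hw.isSmooth_slice hs
    have hr' : r s = δ s - w s := rfl
    rw [hr', divergence_sub (hδs.isContDiff (by simp)) (hws.isContDiff (by simp)),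
      hδdiv s hs x, hwdiv s hs x, sub_zero]
  have hGZeq : ∀ s, GZ s = -convect (δ s) (δ s) := by
    intro s
    funext y
    simp only [hGZ_def, hG_def, hZ_def, sub_zero, Pi.neg_apply]
  have hGZ : ∀ s ∈ Icc a b, IsSmooth (GZ s) := by
    intro s hs
    rw [hGZeq s]
    exact ((hδ.isSmooth_slice hs).convect (hδ.isSmooth_slice hs)).neg
  have hlinδ : ∀ s ∈ Icc a b, ∀ x, timeDerivWithin (Icc a b) δ s x + convect (u₁ s) (δ s) x +
      convect (δ s) (u₁ s) x = ν • laplacian (δ s) x - gradient (fun y => p₂ s y - p₁ s y) x +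
        G s x := fun s hs x => h₁.linearisedNSForced_sub h₂ hab hs x
  have hlinw : ∀ s ∈ Icc a b, ∀ x, timeDerivWithin (Icc a b) w s x + convect (u₁ s) (w s) x +
      convect (w s) (u₁ s) x = ν • laplacian (w s) x - gradient (q s) x + Z s x := by
    intro s hs x
    rw [hlin s hs x, hZ_def, add_zero]
  have hlinr : ∀ s ∈ Icc a b, ∀ x, timeDerivWithin (Icc a b) r s x + convect (u₁ s) (r s) x +
      convect (r s) (u₁ s) x = ν • laplacian (r s) x - gradient (π s) x + GZ s x :=
    fun s hs x => linearisedNSForced_sub_eq hδ hp21 hlinδ hw hq hlinw hab hs x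
  -- the functions of time
  set Vr : ℝ → ℝ := fun s => gradNormSq (r s) with hVr
  set Vδ : ℝ → ℝ := fun s => gradNormSq (δ s) with hVδ
  set Eδ : ℝ → ℝ := fun s => ∫ x, ‖δ s x‖ ^ 2 with hEδ
  set Er : ℝ → ℝ := fun s => ∫ x, ‖r s x‖ ^ 2 with hEr
  set Dδ : ℝ → ℝ := fun s => ∫ x, ‖laplacian (δ s) x‖ ^ 2 with hDδ
  set Dr : ℝ → ℝ := fun s => ∫ x, ‖laplacian (r s) x‖ ^ 2 with hDr
  set Vr' : ℝ → ℝ := fun s => -(2 * ν * ∫ x, ‖laplacian (r s) x‖ ^ 2) +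
    2 * (∫ x, ⟪convect (u₁ s) (r s) x + convect (r s) (u₁ s) x, laplacian (r s) x⟫_ℝ) -
    2 * ∫ x, ⟪GZ s x, laplacian (r s) x⟫_ℝ with hVr'
  set Vδ' : ℝ → ℝ := fun s => -(2 * ν * ∫ x, ‖laplacian (fun y => u₂ s y - u₁ s y) x‖ ^ 2) +
    2 * ∫ x, ⟪convect (u₂ s) (fun y => u₂ s y - u₁ s y) x +
      convect (fun y => u₂ s y - u₁ s y) (u₁ s) x, laplacian (fun y => u₂ s y - u₁ s y) x⟫_ℝ
    with hVδ'
  have hdVr : ∀ s ∈ Icc a b, HasDerivWithinAt Vr (Vr' s) (Icc a b) s := fun s hs =>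
    linearisedNSForced_hasDerivWithinAt_gradNormSq h₁.smooth_velocity hr hπ hrdiv hGZ hlinr hab hs
  have hdVδ : ∀ s ∈ Icc a b, HasDerivWithinAt Vδ (Vδ' s) (Icc a b) s := fun s hs =>
    h₂.hasDerivWithinAt_gradNormSq_sub h₁ hab hs
  have hVδ0 : ∀ s, 0 ≤ Vδ s := fun s => gradNormSq_nonneg _
  have hEδ0 : ∀ s, 0 ≤ Eδ s := fun s => integral_nonneg fun x => sq_nonneg _
  have hDδ0 : ∀ s, 0 ≤ Dδ s := fun s => integral_nonneg fun x => sq_nonneg _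
  -- a priori bounds from part I
  have hEr_le : ∀ s ∈ Icc a b, Er s ≤ KB * H₀ ^ 2 := fun s hs =>
    hKB h₁ h₂ hz₁ hz₂ hM₂ hC hCΛ hw hq hwdiv hlin h0 s hs
  have hQ : ∀ s ∈ Icc a b, ∫ x, ‖δ s x‖ ^ 4 ≤ K₄ * H₀ ^ 2 := fun s hs =>
    hK₄ h₁ h₂ hz₁ hz₂ hM₂ hC hCΛ s hs
  have hH1 : ∀ s ∈ Icc a b, Eδ s + Vδ s ≤ H₀ * Real.exp (K' * τ) := by
    intro s hs
    have h := IsClassicalNSSolutionOn.h1_sub_le_mul_exp hν hΛ h₂ h₁ hab hM₂ hC hCΛ hs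
    have hexp : Real.exp (K' * (s - a)) ≤ Real.exp (K' * τ) := by
      refine Real.exp_le_exp.2 (mul_le_mul_of_nonneg_left ?_ hK'0)
      rw [hb] at hs; linarith [hs.2]
    exact h.trans (mul_le_mul_of_nonneg_left hexp hH₀0)
  -- the source in `L²`: `∫ ‖(δ·∇)δ‖² ≤ c₁ H₀ ‖Δδ‖₂²`
  have hsrc : ∀ s ∈ Icc a b, ∫ x, ‖GZ s x‖ ^ 2 ≤ c₁ * H₀ * Dδ s := by
    intro s hs
    have hδs : IsSmooth (δ s) := hδ.isSmooth_slice hs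
    have h1 : ∫ x, ‖GZ s x‖ ^ 2 = ∫ x, ‖convect (δ s) (δ s) x‖ ^ 2 := by
      rw [hGZeq s]
      exact integral_congr_ae (ae_of_all _ fun x => by simp only [Pi.neg_apply, norm_neg])
    rw [h1]
    have h2 := integral_norm_sq_convect_self_le hδs
    have h3 : Real.sqrt (∫ x, ‖δ s x‖ ^ 4) ≤ Real.sqrt K₄ * H₀ := by
      calc Real.sqrt (∫ x, ‖δ s x‖ ^ 4) ≤ Real.sqrt (K₄ * H₀ ^ 2) := Real.sqrt_le_sqrt (hQ s hs)
        _ = Real.sqrt K₄ * H₀ := by rw [Real.sqrt_mul hK₄0, Real.sqrt_sq hH₀0]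
    have h4 : Real.sqrt (∫ x, (∑ i, ‖partialDeriv i (δ s) x‖ ^ 2) ^ 2) ≤ Real.sqrt KG * Dδ s := by
      calc Real.sqrt (∫ x, (∑ i, ‖partialDeriv i (δ s) x‖ ^ 2) ^ 2)
          ≤ Real.sqrt (KG * Dδ s ^ 2) := Real.sqrt_le_sqrt (hKG _ hδs)
        _ = Real.sqrt KG * Dδ s := by rw [Real.sqrt_mul hKG0, Real.sqrt_sq (hDδ0 s)]
    calc ∫ x, ‖convect (δ s) (δ s) x‖ ^ 2
        ≤ Real.sqrt (∫ x, ‖δ s x‖ ^ 4) * Real.sqrt (∫ x, (∑ i, ‖partialDeriv i (δ s) x‖ ^ 2) ^ 2) := h2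
      _ ≤ (Real.sqrt K₄ * H₀) * (Real.sqrt KG * Dδ s) :=
          mul_le_mul h3 h4 (Real.sqrt_nonneg _) (by positivity)
      _ = c₁ * H₀ * Dδ s := by simp only [hc₁]; ring
  -- flux of the remainder: `V_r' ≤ K₁ V_r + (4Λ²/ν) K_B H₀² + (2/ν) c₁ H₀ ‖Δδ‖₂²`
  have hfluxr : ∀ s ∈ Icc a b, Vr' s ≤ K₁ * Vr s + 4 * Λ ^ 2 / ν * KB * H₀ ^ 2 +
      2 / ν * (c₁ * H₀ * Dδ s) := by
    intro s hs
    have hu₁s : IsSmooth (u₁ s) := h₁.smooth_velocity.isSmooth_slice hs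
    have hrs : IsSmooth (r s) := hr.isSmooth_slice hs
    have h : Vr' s ≤ -(ν * Dr s) + ν⁻¹ * (4 * Dd * Vr s + 4 * (∑ i, C i) ^ 2 * Er s +
        2 * ∫ x, ‖GZ s x‖ ^ 2) :=
      linearisedNSForced_gradNormSq_flux_le hν hu₁s hrs (hGZ s hs) (hM₁ s hs) fun i x => hC i s hs x
    have hL2 : (∑ i, C i) ^ 2 ≤ Λ ^ 2 := pow_le_pow_left₀ hL0 hCΛ 2
    have hν0 : 0 ≤ ν⁻¹ := (inv_pos.2 hν).le
    have t1 : 4 * (∑ i, C i) ^ 2 * Er s ≤ 4 * Λ ^ 2 * (KB * H₀ ^ 2) := by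
      have hEs0 : 0 ≤ Er s := integral_nonneg fun x => sq_nonneg _
      calc 4 * (∑ i, C i) ^ 2 * Er s ≤ 4 * Λ ^ 2 * Er s := by gcongr
        _ ≤ 4 * Λ ^ 2 * (KB * H₀ ^ 2) := by gcongr; exact hEr_le s hs
    have hin : 4 * Dd * Vr s + 4 * (∑ i, C i) ^ 2 * Er s + 2 * ∫ x, ‖GZ s x‖ ^ 2 ≤
        4 * Dd * Vr s + 4 * Λ ^ 2 * (KB * H₀ ^ 2) + 2 * (c₁ * H₀ * Dδ s) :=
      add_le_add (add_le_add le_rfl t1) (mul_le_mul_of_nonneg_left (hsrc s hs) zero_le_two)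
    have hneg : -(ν * Dr s) ≤ 0 :=
      neg_nonpos.2 (mul_nonneg hν.le (integral_nonneg fun x => sq_nonneg _))
    have e : K₁ * Vr s + 4 * Λ ^ 2 / ν * KB * H₀ ^ 2 + 2 / ν * (c₁ * H₀ * Dδ s) =
        ν⁻¹ * (4 * Dd * Vr s + 4 * Λ ^ 2 * (KB * H₀ ^ 2) + 2 * (c₁ * H₀ * Dδ s)) := by
      simp only [hK₁]
      field_simp
    calc Vr' s ≤ -(ν * Dr s) + ν⁻¹ * (4 * Dd * Vr s + 4 * (∑ i, C i) ^ 2 * Er s +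
          2 * ∫ x, ‖GZ s x‖ ^ 2) := h
      _ ≤ 0 + ν⁻¹ * (4 * Dd * Vr s + 4 * Λ ^ 2 * (KB * H₀ ^ 2) + 2 * (c₁ * H₀ * Dδ s)) :=
          add_le_add hneg (mul_le_mul_of_nonneg_left hin hν0)
      _ = _ := by rw [zero_add, e]
  -- flux of the perturbation with half the dissipation kept
  have hfluxδ : ∀ s ∈ Icc a b, Vδ' s ≤ -(ν * Dδ s) +
      2 / ν * (Dd + Λ ^ 2) * (H₀ * Real.exp (K' * τ)) := by
    intro s hs
    have hu₁s : IsSmooth (u₁ s) := h₁.smooth_velocity.isSmooth_slice hs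
    have hu₂s : IsSmooth (u₂ s) := h₂.smooth_velocity.isSmooth_slice hs
    have hδs : IsSmooth (δ s) := hδ.isSmooth_slice hs
    have hF : IsSmooth (fun x => convect (u₂ s) (δ s) x + convect (δ s) (u₁ s) x) :=
      (hu₂s.convect hδs).add (hδs.convect hu₁s)
    set NF : ℝ := ∫ x, ‖convect (u₂ s) (δ s) x + convect (δ s) (u₁ s) x‖ ^ 2 with hNF
    set P : ℝ := ∫ x, ⟪convect (u₂ s) (δ s) x + convect (δ s) (u₁ s) x, laplacian (δ s) x⟫_ℝ
      with hP
    have hY : -(ν / 2) * Dδ s + P ≤ (4 * (ν / 2))⁻¹ * NF :=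
      Literature.Analysis.FluidPDE.Torus.neg_mul_integral_norm_sq_add_integral_inner_le
        (half_pos hν) hF hδs.laplacian
    have hB : NF ≤ 2 * Dd * Vδ s + 2 * (∑ i, C i) ^ 2 * Eδ s :=
      integral_norm_sq_convect_add_convect_le (u₁ := u₂ s) hu₁s hδs (hM₂ s hs)
        fun i x => hC i s hs x
    have hL2 : (∑ i, C i) ^ 2 ≤ Λ ^ 2 := pow_le_pow_left₀ hL0 hCΛ 2
    have h4 : (4 * (ν / 2))⁻¹ = 2⁻¹ * ν⁻¹ := by rw [mul_inv]; field_simp; norm_num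
    rw [h4] at hY
    have hν0 : 0 ≤ ν⁻¹ := (inv_pos.2 hν).le
    have t3 : (Dd + Λ ^ 2) * (Eδ s + Vδ s) ≤ (Dd + Λ ^ 2) * (H₀ * Real.exp (K' * τ)) :=
      mul_le_mul_of_nonneg_left (hH1 s hs) (by positivity)
    have hW : NF ≤ 2 * ((Dd + Λ ^ 2) * (H₀ * Real.exp (K' * τ))) := by
      have s1 : 2 * (∑ i, C i) ^ 2 * Eδ s ≤ 2 * Λ ^ 2 * Eδ s :=
        mul_le_mul_of_nonneg_right (mul_le_mul_of_nonneg_left hL2 zero_le_two) (hEδ0 s)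
      have s2 : Dd * Vδ s + Λ ^ 2 * Eδ s ≤ (Dd + Λ ^ 2) * (Eδ s + Vδ s) := by
        have p1 : 0 ≤ Dd * Eδ s := mul_nonneg hDd0 (hEδ0 s)
        have p2 : 0 ≤ Λ ^ 2 * Vδ s := mul_nonneg (sq_nonneg Λ) (hVδ0 s)
        have e : (Dd + Λ ^ 2) * (Eδ s + Vδ s) =
            Dd * Vδ s + Λ ^ 2 * Eδ s + (Dd * Eδ s + Λ ^ 2 * Vδ s) := by ring
        rw [e]
        linarith
      calc NF ≤ 2 * Dd * Vδ s + 2 * (∑ i, C i) ^ 2 * Eδ s := hB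
        _ ≤ 2 * Dd * Vδ s + 2 * Λ ^ 2 * Eδ s := add_le_add le_rfl s1
        _ = 2 * (Dd * Vδ s + Λ ^ 2 * Eδ s) := by ring
        _ ≤ 2 * ((Dd + Λ ^ 2) * (Eδ s + Vδ s)) := mul_le_mul_of_nonneg_left s2 zero_le_two
        _ ≤ 2 * ((Dd + Λ ^ 2) * (H₀ * Real.exp (K' * τ))) := mul_le_mul_of_nonneg_left t3 zero_le_two
    have hNW : ν⁻¹ * NF ≤ ν⁻¹ * (2 * ((Dd + Λ ^ 2) * (H₀ * Real.exp (K' * τ)))) :=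
      mul_le_mul_of_nonneg_left hW hν0
    have hY2 : 2 * (-(ν / 2) * Dδ s + P) ≤ 2 * (2⁻¹ * ν⁻¹ * NF) :=
      mul_le_mul_of_nonneg_left hY zero_le_two
    have e2 : 2 / ν * (Dd + Λ ^ 2) * (H₀ * Real.exp (K' * τ)) =
        ν⁻¹ * (2 * ((Dd + Λ ^ 2) * (H₀ * Real.exp (K' * τ)))) := by field_simp
    have hgoal : Vδ' s = -(2 * ν * Dδ s) + 2 * P := rfl
    rw [hgoal, e2]
    calc -(2 * ν * Dδ s) + 2 * P = -(ν * Dδ s) + 2 * (-(ν / 2) * Dδ s + P) := by ring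
      _ ≤ -(ν * Dδ s) + 2 * (2⁻¹ * ν⁻¹ * NF) := add_le_add le_rfl hY2
      _ = -(ν * Dδ s) + ν⁻¹ * NF := by field_simp
      _ ≤ -(ν * Dδ s) + ν⁻¹ * (2 * ((Dd + Λ ^ 2) * (H₀ * Real.exp (K' * τ)))) :=
          add_le_add le_rfl hNW
  -- the Lyapunov combination `Φ = V_r + λ H₀ V_δ`
  set Φ : ℝ → ℝ := fun s => Vr s + lam * H₀ * Vδ s with hΦ
  set Φ' : ℝ → ℝ := fun s => Vr' s + lam * H₀ * Vδ' s with hΦ'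
  have hdΦ : ∀ s ∈ Icc a b, HasDerivWithinAt Φ (Φ' s) (Icc a b) s := fun s hs =>
    (hdVr s hs).add ((hdVδ s hs).const_mul (lam * H₀))
  have hΦ'le : ∀ s ∈ Icc a b, Φ' s ≤ K₁ * Φ s + c₂ * H₀ ^ 2 := by
    intro s hs
    have h1 := hfluxr s hs
    have h2 := mul_le_mul_of_nonneg_left (hfluxδ s hs) (mul_nonneg hlam0 hH₀0)
    have hcancel : 2 / ν * (c₁ * H₀ * Dδ s) + lam * H₀ * -(ν * Dδ s) = 0 := by
      simp only [hlam]; field_simp; ring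
    have hΦge : Vr s ≤ Φ s := le_add_of_nonneg_right (mul_nonneg (mul_nonneg hlam0 hH₀0) (hVδ0 s))
    have hK₁Φ : K₁ * Vr s ≤ K₁ * Φ s := mul_le_mul_of_nonneg_left hΦge hK₁0
    have hrest : 4 * Λ ^ 2 / ν * KB * H₀ ^ 2 +
        lam * H₀ * (2 / ν * (Dd + Λ ^ 2) * (H₀ * Real.exp (K' * τ))) = c₂ * H₀ ^ 2 := by
      simp only [hc₂]; ring
    calc Φ' s = Vr' s + lam * H₀ * Vδ' s := rfl
      _ ≤ (K₁ * Vr s + 4 * Λ ^ 2 / ν * KB * H₀ ^ 2 + 2 / ν * (c₁ * H₀ * Dδ s)) +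
            lam * H₀ * (-(ν * Dδ s) + 2 / ν * (Dd + Λ ^ 2) * (H₀ * Real.exp (K' * τ))) :=
          add_le_add h1 h2
      _ = K₁ * Vr s + (4 * Λ ^ 2 / ν * KB * H₀ ^ 2 +
            lam * H₀ * (2 / ν * (Dd + Λ ^ 2) * (H₀ * Real.exp (K' * τ)))) +
            (2 / ν * (c₁ * H₀ * Dδ s) + lam * H₀ * -(ν * Dδ s)) := by ring
      _ ≤ K₁ * Φ s + c₂ * H₀ ^ 2 := by rw [hcancel, hrest, add_zero]; linarith
  -- Grönwall
  have hΦc : ContinuousOn Φ (Icc a b) := fun s hs => (hdΦ s hs).continuousWithinAt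
  have hder : ∀ s ∈ Ico a b, HasDerivWithinAt Φ (Φ' s) (Ici s) s := fun s hs =>
    ((hdΦ s (Ico_subset_Icc_self hs)).mono (Icc_subset_Icc hs.1 le_rfl)).mono_of_mem_nhdsWithin
      (Icc_mem_nhdsGE hs.2)
  have hgr := le_gronwallBound_of_liminf_deriv_right_le (f := Φ) (f' := Φ') (δ := Φ a)
    (K := K₁) (ε := c₂ * H₀ ^ 2) (a := a) (b := b) hΦc
    (fun s hs ρ hρ => (hder s hs).liminf_right_slope_le hρ) le_rfl
    (fun s hs => hΦ'le s (Ico_subset_Icc_self hs)) t ht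
  have hgr' := hgr.trans (Literature.Analysis.ODE.gronwallBound_le_mul_exp (by positivity) hK₁0)
  -- the initial value: `V_r(a) = 0`, `V_δ(a) ≤ H₀`
  have hVra : Vr a = 0 := by
    have h : r a = fun _ => 0 := funext fun y => by simp only [hr_def, hδ_def, h0, sub_self]
    simp only [hVr, h, gradNormSq_fun_zero]
  have hΦa : Φ a ≤ lam * H₀ ^ 2 := by
    have hVδa : Vδ a ≤ H₀ := le_add_of_nonneg_left (integral_nonneg fun x => sq_nonneg _)
    calc Φ a = lam * H₀ * Vδ a := by simp only [hΦ, hVra, zero_add]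
      _ ≤ lam * H₀ * H₀ := mul_le_mul_of_nonneg_left hVδa (mul_nonneg hlam0 hH₀0)
      _ = lam * H₀ ^ 2 := by ring
  have ht1 : 0 ≤ t - a := by linarith [ht.1]
  have ht2 : t - a ≤ τ := by rw [hb] at ht; linarith [ht.2]
  have hexp : Real.exp (K₁ * (t - a)) ≤ Real.exp (K₁ * τ) :=
    Real.exp_le_exp.2 (mul_le_mul_of_nonneg_left ht2 hK₁0)
  calc gradNormSq (fun y => u₂ t y - u₁ t y - w t y) = Vr t := rfl
    _ ≤ Φ t := le_add_of_nonneg_right (mul_nonneg (mul_nonneg hlam0 hH₀0) (hVδ0 t))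
    _ ≤ (Φ a + c₂ * H₀ ^ 2 * (t - a)) * Real.exp (K₁ * (t - a)) := hgr'
    _ ≤ (lam * H₀ ^ 2 + c₂ * H₀ ^ 2 * τ) * Real.exp (K₁ * τ) :=
        mul_le_mul (add_le_add hΦa (mul_le_mul_of_nonneg_left ht2 (mul_nonneg hc₂0 (sq_nonneg _))))
          hexp (Real.exp_pos _).le
          (add_nonneg (mul_nonneg hlam0 (sq_nonneg _)) (mul_nonneg (mul_nonneg hc₂0 (sq_nonneg _)) hτ.le))
    _ = (lam + c₂ * τ) * Real.exp (K₁ * τ) * H₀ ^ 2 := by ring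

/-- **Fréchet differentiability of the Navier–Stokes solution map in `V = H¹` on `T³`, with a
locally uniform quadratic remainder.** On `T^d` with `card d = 3`, for `ν > 0`, `Λ ≥ 0`, `τ > 0`
and `M` there is `K ≥ 0` such that, in the setting of
`Torus.IsClassicalNSSolutionOn.exists_gradNormSq_sub_sub_le`, the remainder `r = u₂ − u₁ − w`
obeys `∫‖r(t)‖² + ‖∇r(t)‖₂² ≤ K (∫‖(u₂ − u₁)(a)‖² + ‖∇(u₂ − u₁)(a)‖₂²)²` on `[a, a + τ]`, i.e.
`‖S(t)u₂(a) − S(t)u₁(a) − S'(t,u₁)(u₂(a) − u₁(a))‖_{H¹} ≤ √K ‖u₂(a) − u₁(a)‖²_{H¹}`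
(parts I and II; Constantin–Foias 1988, Lemma 14.3: "`S'(t,u₀)` is the Fréchet derivative of
`S(t)`", here as a map of `V` into `V`). [cite: ConstantinFoiasNSE1988, Ch. 14 Lemma 14.3 (14.10)] -/
theorem IsClassicalNSSolutionOn.exists_h1_sub_sub_le (hd : Fintype.card d = 3)
    (hν : 0 < ν) (hΛ : 0 ≤ Λ) (hτ : 0 < τ) (M : ℝ) :
    ∃ K : ℝ, 0 ≤ K ∧ ∀ {a : ℝ} {f u₁ u₂ w : ℝ → UnitAddTorus d → EuclideanSpace ℝ d}
      {p₁ p₂ q : ℝ → UnitAddTorus d → ℝ} {C : d → ℝ},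
      IsClassicalNSSolutionOn (Icc a (a + τ)) ν f u₁ p₁ →
      IsClassicalNSSolutionOn (Icc a (a + τ)) ν f u₂ p₂ →
      (∀ t ∈ Icc a (a + τ), HasZeroMean (u₁ t)) → (∀ t ∈ Icc a (a + τ), HasZeroMean (u₂ t)) →
      (∀ t ∈ Icc a (a + τ), ∀ x, ‖u₁ t x‖ ≤ M) → (∀ t ∈ Icc a (a + τ), ∀ x, ‖u₂ t x‖ ≤ M) →
      (∀ i, ∀ t ∈ Icc a (a + τ), ∀ x, ‖partialDeriv i (u₁ t) x‖ ≤ C i) → ∑ i, C i ≤ Λ →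
      IsSmoothSpaceTimeOn (Icc a (a + τ)) w → IsSmoothSpaceTimeOn (Icc a (a + τ)) q →
      (∀ t ∈ Icc a (a + τ), IsDivFree (w t)) →
      (∀ t ∈ Icc a (a + τ), ∀ x, timeDerivWithin (Icc a (a + τ)) w t x + convect (u₁ t) (w t) x +
        convect (w t) (u₁ t) x = ν • laplacian (w t) x - gradient (q t) x) →
      (∀ y, w a y = u₂ a y - u₁ a y) →
      ∀ t ∈ Icc a (a + τ), (∫ x, ‖u₂ t x - u₁ t x - w t x‖ ^ 2) +
          gradNormSq (fun y => u₂ t y - u₁ t y - w t y) ≤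
        K * ((∫ x, ‖u₂ a x - u₁ a x‖ ^ 2) + gradNormSq (fun y => u₂ a y - u₁ a y)) ^ 2 := by
  obtain ⟨KB, hKB0, hKB⟩ :=
    IsClassicalNSSolutionOn.exists_integral_norm_sub_sub_sq_le (d := d) hd hν hΛ hτ M
  obtain ⟨KV, hKV0, hKV⟩ :=
    IsClassicalNSSolutionOn.exists_gradNormSq_sub_sub_le (d := d) hd hν hΛ hτ M
  refine ⟨KB + KV, by positivity, ?_⟩
  intro a f u₁ u₂ w p₁ p₂ q C h₁ h₂ hz₁ hz₂ hM₁ hM₂ hC hCΛ hw hq hwdiv hlin h0 t ht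
  have h1 := hKB h₁ h₂ hz₁ hz₂ hM₂ hC hCΛ hw hq hwdiv hlin h0 t ht
  have h2 := hKV h₁ h₂ hz₁ hz₂ hM₁ hM₂ hC hCΛ hw hq hwdiv hlin h0 t ht
  linarith

end Three

end Torus

end Literature.Analysis.FunctionSpaces
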